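import Literature.NumberTheory.Sieve.HardyLittlewood
import Literature.NumberTheory.Sieve.SingularSeriesPairProofs
import Literature.NumberTheory.Sieve.SingularSeriesProofs
import Literature.NumberTheory.LFunctions.LogIntegralProofs
import HarnessLib

/-!
# Discharged fact: the parity.S10 packaging identity `𝔖({0, 2}) = 2 C₂`

`Literature.NumberTheory.Sieve.HardyLittlewood` records, as the named fact
`Literature.NumberTheory.Sieve.singularSeries_pair_eq_two_mul_twinPrimeConst` (parity.S10 packaging; D-0014), the identity
`singularSeries {0, 2} = 2 * twinPrimeConst`, i.e. `𝔖({0, 2}) = 2 C₂`: the Hardy–Littlewood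
singular series of the twin-prime tuple `{0, 2}`, in the `k`-tuple normalisation
`𝔖(H) = ∏_p (1 - ν_H(p)/p)(1 - 1/p)^{-k}` of `Literature.NumberTheory.Sieve.SingularSeries`
(Halberstam–Richert, *Sieve Methods*, ch. 10), is twice the twin prime constant
`C₂ = ∏_{p > 2} (1 - 1/(p-1)²)` (`Literature.NumberTheory.Sieve.twinPrimeConst`, an ordered limit, D-SIEVE-1).

The statement is *verbatim* that of the prelude fact `Literature.NumberTheory.Sieve.singularSeries_pair` of
`Literature.NumberTheory.Sieve.SingularSeries` (the HardyLittlewood file restates it for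
parity.S10), and that fact is proved in `Literature.NumberTheory.Sieve.SingularSeriesPairProofs`
(`Literature.NumberTheory.Sieve.singularSeries_pair_holds`): for `H = {0, 2}` one has `ν_H(2) = 1` and `ν_H(p) = 2` for
`p > 2`, so the Euler factor is `(1 - 1/2)(1 - 1/2)^{-2} = 2` at `p = 2` and
`(1 - 2/p)(1 - 1/p)^{-2} = p(p-2)/(p-1)² = 1 - 1/(p-1)²` at `p > 2`; hence the ordered partial
products of `𝔖({0, 2})` are twice those of `C₂` from `x = 2` on
(`Literature.NumberTheory.Sieve.singularSeriesPartial_pair`), the former converge (`Literature.NumberTheory.Sieve.tendsto_singularSeriesPartial_holds`),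
and `C₂`, *defined* as the ordered limit of the latter, equals `𝔖({0, 2})/2`
(`Filter.Tendsto.limUnder_eq`). The discharge below is the one-line transport of that proof; no
new mathematics lives in this file.

Source check. Hardy–Littlewood 1923 define `C₂ = ∏_{ϖ=3}^{∞} (1 - 1/(ϖ-1)²)` with Conjecture A
((4·11)–(4·12), p. 32), state Conjecture B (p. 42: for every even `k` there are infinitely many
prime pairs `(p, p + k)`, and `P_k(n) ∼ 2 C₂ (n/(log n)²) ∏ (p-1)/(p-2)` over the odd prime
divisors `p` of `k`, "where `C₂` is the constant of §4"), and specialise to `k = 2` in (5·311)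
(p. 43): `P₂(n) ∼ 2 C₂ n/(log n)²`. The constant `2 C₂` of (5·311) is exactly `𝔖({0, 2})` in the
Halberstam–Richert normalisation, so the vendored fact is stated correctly (no correction needed,
nothing weakened).

## References

* G. H. Hardy, J. E. Littlewood, *Some problems of 'Partitio numerorum'; III: On the expression of
  a number as a sum of primes*, Acta Math. 44 (1923), 1–70: (4·11)–(4·12) p. 32, Conjecture B
  p. 42, (5·311) p. 43. doi:10.1007/BF02403921. [HardyLittlewood1923]
* H. Halberstam, H.-E. Richert, *Sieve Methods*, Academic Press 1974, ch. 10 (the `k`-tuple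
  singular series).
-/

noncomputable section

namespace Literature.NumberTheory.Sieve

/-- **parity.S10** — **discharge of `singularSeries_pair_eq_two_mul_twinPrimeConst`**:
`𝔖({0, 2}) = 2 C₂`, i.e. `singularSeries {0, 2} = 2 * twinPrimeConst`, transported from
`Literature.NumberTheory.Sieve.singularSeries_pair_holds` (`Literature.NumberTheory.Sieve.SingularSeriesPairProofs`), the
prelude fact `Literature.NumberTheory.Sieve.singularSeries_pair` having the identical statement. Hardy–Littlewood, Acta
Math. 44 (1923): `C₂` from (4·12) (p. 32), Conjecture B (p. 42), and (5·311) (p. 43)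
`P₂(n) ∼ 2 C₂ n/(log n)²`; Halberstam–Richert, *Sieve Methods*, ch. 10.
[cite: HardyLittlewood1923, Conjecture B (p. 42) and eq. (5.311) (p. 43)] -/
theorem singularSeries_pair_eq_two_mul_twinPrimeConst_holds :
    singularSeries_pair_eq_two_mul_twinPrimeConst :=
  singularSeries_pair_holds

/-!
## Appendix: the status of `Literature.NumberTheory.Sieve.HardyLittlewoodTuples`, and the remaining discharges

`Literature.NumberTheory.Sieve.HardyLittlewood` records the Hardy–Littlewood prime `k`-tuples
conjecture as the named fact (D-0014)

* `Literature.NumberTheory.Sieve.HardyLittlewoodTuples` : for every admissible `H : Finset ℤ` (`k = #H`),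
  `π_H(x) ∼ 𝔖(H) · x / (log x)^k` (`x → ∞` along `ℕ`),

together with its `Li_k` form `Literature.NumberTheory.Sieve.HardyLittlewoodTuplesLi` and four elementary packaging facts.

### 1. `HardyLittlewoodTuples` is an open conjecture — it is *not* discharged here

Source check. Hardy–Littlewood 1923 state the general prime-group asymptotic as **Theorem X 1**
(p. 61): for distinct integers `b₁, …, b_m`, the number `P(x; b₁, …, b_m)` of groups
`n + b₁, …, n + b_m` between `1` and `x` consisting wholly of primes satisfies
`P(x) ∼ G(b₁, …, b_m) Li_m(x)` ((5·663)), with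
`G = ∏_ϖ (ϖ/(ϖ-1))^{m-1} (ϖ - ν)/(ϖ - 1)` ((5·664)), `ν = ν(ϖ; b)` the number of distinct residues
of the `b`'s modulo `ϖ`, and `Li_m(x) = ∫₂ˣ du/(log u)^m`.  Since
`(ϖ/(ϖ-1))^{m-1} (ϖ-ν)/(ϖ-1) = (1 - ν/ϖ)(1 - 1/ϖ)^{-m}`, `G` is exactly the tree's
`Literature.NumberTheory.Sieve.singularSeries` (Halberstam–Richert normalisation), `P(x; b)` is `Literature.NumberTheory.Sieve.primeTupleCount`, and
`Li_m` is `Literature.offsetLogIntegralPow m`; so `Literature.NumberTheory.Sieve.HardyLittlewoodTuplesLi` is Theorem X 1 verbatim and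
`Literature.NumberTheory.Sieve.HardyLittlewoodTuples` is its `x/(log x)^m` form (equivalent: `hardyLittlewoodTuples_iff_li_holds`
below).  The statement is faithful and is **not** mis-stated.  The asterisk on "Theorem X 1*" marks
(p. 56, "Hypothesis X"; footnote p. 61) that it is proved only under the unproved Hypothesis X: it
is a conjecture.  Its case `m = 2`, `b = (0, 2)` is **Conjecture B** (p. 42: "There are infinitely
many prime pairs `(p, p + k)` for every even `k`", with `P₂(n) ∼ 2 C₂ n/(log n)²`, (5·311), p. 43),
and already this case is open: Hardy–Wright, *An Introduction to the Theory of Numbers*, §22.20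
("it is not known whether there is an infinity of prime-pairs `p, p+2`", conjectural formula
(22.20.1) `P₂(x) ∼ 2C₂x/(log x)²`); Crandall–Pomerance, *Prime Numbers*, Conjecture 1.2.1 (prime
`k`-tuples conjecture).  Accordingly no `HardyLittlewoodTuples_holds` can be given.  What *is*
proved here is the reduction making this precise inside the tree:

* `Literature.NumberTheory.Sieve.HardyLittlewoodTuples.tendsto_primeTupleCount_atTop` : under the conjecture,
  `π_H(x) → ∞` for every admissible `H` (uses `𝔖(H) > 0`, `singularSeries_pos_iff_holds`);
* `Literature.NumberTheory.Sieve.HardyLittlewoodTuples.setOf_primeTuple_infinite` : under the conjecture every admissible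
  tuple is a prime tuple for infinitely many `n` (the qualitative prime `k`-tuples conjecture);
* `Literature.NumberTheory.Sieve.HardyLittlewoodTuples.twinPrimeConjecture` : the conjecture implies the twin prime
  conjecture `Literature.NumberTheory.Sieve.TwinPrimeConjecture` (**parity.S03**, open).

(`Literature.NumberTheory.Sieve.HardyLittlewoodGoldbach`, Conjecture A, is likewise open and untouched; the
`TwinSieveUpperBound C` instances are deep sieve theorems vendored as facts and are not the
subject of this file.)

### 2. The remaining discharged facts of `HardyLittlewood.lean`

* `Literature.NumberTheory.Sieve.hardyLittlewoodTuples_iff_li_holds` : `HardyLittlewoodTuples ↔ HardyLittlewoodTuplesLi`,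
  from `Li_k(x) ∼ x/(log x)^k` (`isEquivalent_offsetLogIntegralPow_holds`);
* `Literature.NumberTheory.Sieve.singularSeries_pos_of_isAdmissibleTuple_holds` (from `singularSeries_pos_iff_holds`);
* `Literature.NumberTheory.Sieve.TwinSieveUpperBound.mono_holds` (monotonicity in `C`, using `C₂ > 0`,
  `twinPrimeConst_pos_holds`).

(`Literature.NumberTheory.Sieve.singularSeries_pair_eq_two_mul_twinPrimeConst_holds` is the discharge above.)

### References for the appendix

* G. H. Hardy, J. E. Littlewood, *Some problems of 'Partitio Numerorum' III: On the expression of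
  a number as a sum of primes*, Acta Math. 44 (1923), 1–70: Conjecture B p. 42, (5·311) p. 43,
  Hypothesis X p. 56, Theorem X 1 ((5·663)–(5·664)) p. 61. doi:10.1007/BF02403921.
  [HardyLittlewood1923]
* G. H. Hardy, E. M. Wright, *An Introduction to the Theory of Numbers*, 6th ed., OUP 2008,
  §22.20, (22.20.1)–(22.20.2).
* R. Crandall, C. Pomerance, *Prime Numbers: A Computational Perspective*, Springer,
  Conjecture 1.2.1.
-/

open Filter Finset Asymptotics
open scoped Topology

/-! ### `x / (log x)^k → ∞` -/

/-- `x / (log x)^k → +∞` as `x → +∞` (`k : ℕ`), from Mathlib's `(log x)^k = o(x)`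
(`Real.isLittleO_pow_log_id_atTop`). [folklore] -/
theorem tendsto_div_log_pow_atTop (k : ℕ) :
    Tendsto (fun x : ℝ ↦ x / Real.log x ^ k) atTop atTop := by
  have h1 : Tendsto (fun x : ℝ ↦ Real.log x ^ k / x) atTop (𝓝 0) := by
    simpa using (Real.isLittleO_pow_log_id_atTop (n := k)).tendsto_div_nhds_zero
  have h2 : Tendsto (fun x : ℝ ↦ Real.log x ^ k / x) atTop (𝓝[>] 0) := by
    refine tendsto_nhdsWithin_iff.mpr ⟨h1, ?_⟩
    filter_upwards [eventually_gt_atTop 1] with x hx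
    exact div_pos (pow_pos (Real.log_pos hx) k) (by linarith)
  refine h2.inv_tendsto_nhdsGT_zero.congr fun x ↦ ?_
  simp [inv_div]

/-- `x / (log x)^k → +∞` along the natural numbers. [folklore] -/
theorem tendsto_natCast_div_log_pow_atTop (k : ℕ) :
    Tendsto (fun x : ℕ ↦ (x : ℝ) / Real.log x ^ k) atTop atTop :=
  (tendsto_div_log_pow_atTop k).comp tendsto_natCast_atTop_atTop

/-! ### Consequences of the prime `k`-tuples conjecture (why it is not discharged) -/

/-- Under `HardyLittlewoodTuples`, `π_H(x) → ∞` for every admissible `H`: the main term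
`𝔖(H) x/(log x)^k` tends to `∞` because `𝔖(H) > 0` (`singularSeries_pos_iff_holds`).
Hardy–Littlewood 1923, Theorem X 1 (p. 61). [cite: HardyLittlewood1923, Theorem X 1] -/
theorem HardyLittlewoodTuples.tendsto_primeTupleCount_atTop (hHL : HardyLittlewoodTuples)
    {H : Finset ℤ} (hH : IsAdmissibleTuple H) :
    Tendsto (fun x : ℕ ↦ (primeTupleCount H x : ℝ)) atTop atTop := by
  refine (hHL H hH).symm.tendsto_atTop ?_
  have hpos : 0 < singularSeries H := (singularSeries_pos_iff_holds H).2 hH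
  simpa [mul_div_assoc] using (tendsto_natCast_div_log_pow_atTop H.card).const_mul_atTop hpos

/-- Under `HardyLittlewoodTuples`, every admissible tuple `H` is a prime tuple for infinitely
many `n`: `{n : n + h is a positive prime for all h ∈ H}` is infinite (the qualitative prime
`k`-tuples conjecture; Crandall–Pomerance, Conjecture 1.2.1). [cite: HardyLittlewood1923, Theorem X 1] -/
theorem HardyLittlewoodTuples.setOf_primeTuple_infinite (hHL : HardyLittlewoodTuples)
    {H : Finset ℤ} (hH : IsAdmissibleTuple H) :
    {n : ℕ | ∀ h ∈ H, 0 < (n : ℤ) + h ∧ ((n : ℤ) + h).toNat.Prime}.Infinite := by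
  intro hfin
  have hle : ∀ x, (primeTupleCount H x : ℝ) ≤ hfin.toFinset.card := fun x ↦ by
    unfold primeTupleCount
    exact_mod_cast card_le_card fun n hn ↦ hfin.mem_toFinset.2 (mem_filter.1 hn).2
  obtain ⟨x, hx⟩ := ((hHL.tendsto_primeTupleCount_atTop hH).eventually
    (eventually_gt_atTop (hfin.toFinset.card : ℝ))).exists
  exact not_lt.2 (hle x) hx

/-- `HardyLittlewoodTuples` implies the twin prime conjecture `Literature.NumberTheory.Sieve.TwinPrimeConjecture`
(**parity.S03**): take the admissible pair `H = {0, 2}` (`isAdmissibleTuple_pair`); this is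
Hardy–Littlewood's Conjecture B (p. 42) for `k = 2`.  In particular a proof of the named fact
`HardyLittlewoodTuples` would settle an open problem (Hardy–Wright §22.20).
[cite: HardyLittlewood1923, Conjecture B] -/
theorem HardyLittlewoodTuples.twinPrimeConjecture (hHL : HardyLittlewoodTuples) :
    Sieve.TwinPrimeConjecture := by
  intro n
  obtain ⟨p, hp, hnp⟩ := (hHL.setOf_primeTuple_infinite isAdmissibleTuple_pair).exists_gt n
  rw [Set.mem_setOf_eq] at hp
  have h0 := hp 0 (by simp)
  have h2 := hp 2 (by simp)
  have e0 : ((p : ℤ) + 0).toNat = p := by omega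
  have e2 : ((p : ℤ) + 2).toNat = p + 2 := by omega
  rw [e0] at h0
  rw [e2] at h2
  exact ⟨p, hnp, h0.2, h2.2⟩

/-! ### The remaining discharged facts of `HardyLittlewood.lean` -/

/-- For every tuple `H` (`k = #H`), `𝔖(H) · Li_k(x) ∼ 𝔖(H) · x/(log x)^k` along `ℕ`, from
`Li_k(x) ∼ x/(log x)^k` (`isEquivalent_offsetLogIntegralPow_holds`; Hardy–Littlewood 1923, §5).
[cite: HardyLittlewood1923, Theorem X 1] -/
theorem isEquivalent_singularSeries_mul_offsetLogIntegralPow (H : Finset ℤ) :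
    (fun x : ℕ ↦ singularSeries H * LFunctions.offsetLogIntegralPow H.card x) ~[atTop]
      fun x : ℕ ↦ singularSeries H * x / Real.log x ^ H.card := by
  have h := (LFunctions.isEquivalent_offsetLogIntegralPow_holds H.card).comp_tendsto
    tendsto_natCast_atTop_atTop
  have := (IsEquivalent.refl (u := fun _ : ℕ ↦ singularSeries H) (l := atTop)).mul h
  simpa only [Pi.mul_def, Function.comp_def, mul_div_assoc] using this

/-- **Discharge of `hardyLittlewoodTuples_iff_li`**: the `x/(log x)^k` and `Li_k` forms of the
prime `k`-tuples conjecture are equivalent, since `Li_k(x) ∼ x/(log x)^k`. (No positivity of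
`𝔖(H)` is needed: asymptotic equivalence is transitive.) Hardy–Littlewood 1923, Theorem X 1.
[cite: HardyLittlewood1923, Theorem X 1] -/
theorem hardyLittlewoodTuples_iff_li_holds : hardyLittlewoodTuples_iff_li := by
  unfold hardyLittlewoodTuples_iff_li HardyLittlewoodTuples HardyLittlewoodTuplesLi
  exact ⟨fun h H hH ↦
      (h H hH).trans (isEquivalent_singularSeries_mul_offsetLogIntegralPow H).symm,
    fun h H hH ↦ (h H hH).trans (isEquivalent_singularSeries_mul_offsetLogIntegralPow H)⟩

/-- The `Li_k` form of the conjecture likewise implies the twin prime conjecture.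
[cite: HardyLittlewood1923, Conjecture B] -/
theorem HardyLittlewoodTuplesLi.twinPrimeConjecture (hHL : HardyLittlewoodTuplesLi) :
    Sieve.TwinPrimeConjecture :=
  (hardyLittlewoodTuples_iff_li_holds.2 hHL).twinPrimeConjecture

/-- **Discharge of `singularSeries_pos_of_isAdmissibleTuple`**: `𝔖(H) > 0` for admissible `H`
(`singularSeries_pos_iff_holds`). Halberstam–Richert ch. 10. [cite: HalberstamRichert1974, Ch. 10] -/
theorem singularSeries_pos_of_isAdmissibleTuple_holds : singularSeries_pos_of_isAdmissibleTuple := by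
  intro H hH
  exact (singularSeries_pos_iff_holds H).2 hH

/-- **Discharge of `TwinSieveUpperBound.mono`**: the sieve bound `π₂(x) ≤ (C + o(1)) 2C₂ x/(log x)²`
is monotone in `C` (as `2 C₂ x/(log x)² ≥ 0`, by `twinPrimeConst_pos_holds`). [folklore] -/
theorem TwinSieveUpperBound.mono_holds : TwinSieveUpperBound.mono := by
  intro C C' h hC ε hε
  filter_upwards [hC ε hε] with x hx
  refine hx.trans ?_
  have hC₂ : (0 : ℝ) < twinPrimeConst := twinPrimeConst_pos_holds
  have h0 : (0 : ℝ) ≤ 2 * twinPrimeConst * x / Real.log x ^ 2 := by positivity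
  calc (C + ε) * 2 * twinPrimeConst * x / Real.log x ^ 2
      = (C + ε) * (2 * twinPrimeConst * x / Real.log x ^ 2) := by ring
    _ ≤ (C' + ε) * (2 * twinPrimeConst * x / Real.log x ^ 2) := by gcongr
    _ = (C' + ε) * 2 * twinPrimeConst * x / Real.log x ^ 2 := by ring

/-!
## Appendix 2: the status of `Literature.NumberTheory.Sieve.HardyLittlewoodGoldbach` (Conjecture A)

`Literature.NumberTheory.Sieve.HardyLittlewoodGoldbach` records, as a named fact (D-0014),
Hardy–Littlewood's **Conjecture A** (Acta Math. 44 (1923), §4.1, p. 32, (4·11)–(4·12)):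
`N₂(n) ∼ 2 C₂ · n/(log n)² · ∏ (p-1)/(p-2)`, the product over the odd prime divisors `p` of the
(even) `n`, with `C₂ = ∏_{ϖ ≥ 3} (1 - 1/(ϖ-1)²)`, where `N_r(n)` is "the number of
representations of `n` by a sum of `r` primes, attention being paid to order, and repetitions
of the same prime being allowed" (§1.2, p. 6).  In the tree `N₂(N)` is
`SingularSeries.goldbachCount N` (ordered pairs over `Finset.antidiagonal N`),
`2 C₂ ∏ (p-1)/(p-2)` is `goldbachSingularSeries N` for even `N` (`goldbachSingularSeries_of_even`)
with `C₂ = twinPrimeConst`, and "large even `n`" is the filter `atTop ⊓ 𝓟 {N | Even N}`; so the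
vendored statement is Conjecture A verbatim — it is faithful and **not** mis-stated.

### It is an open conjecture — no `HardyLittlewoodGoldbach_holds` can be given

Hardy–Littlewood state (4·11) as a conjecture, not a theorem: "Our method fails when `r = 2`.
It does not fail in principle, for it leads to a definite result which appears to be correct;
but we cannot overcome the difficulties of the proof, even if we assume that `Θ = 1/2`"
(§4.1, p. 32) — i.e. not even on the generalised Riemann hypothesis.  The asymptotic formula
contains the first clause of Conjecture A, "every large even number is the sum of two odd
primes": this is made precise below (`HardyLittlewoodGoldbach.exists_forall_exists_prime_add_eq`),
so a proof of the named fact would settle the binary Goldbach problem for all large even `N`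
(cf. `Literature.NumberTheory.Sieve.GoldbachConjecture`, **parity.S04**, open) and make the
Goldbach exceptional set finite (`HardyLittlewoodGoldbach.exists_goldbachExceptionalCount_le`),
whereas the tree's unconditional knowledge is Chen's `p + P₂` (`chen_goldbach`) and the
exceptional-set bounds `E(x) ≪ x^{1-δ}` (Montgomery–Vaughan 1975,
`goldbachExceptionalCount_isBigO_rpow`) and `E(x) ≪ x^{0.879}` (Lu 2010,
`goldbachExceptionalCount_isBigO_rpow_lu`).  Accordingly the fact is left undischarged; what
*is* proved here is the reduction making its strength precise inside the tree:

* `two_mul_twinPrimeConst_le_goldbachSingularSeries` : `2 C₂ ≤ 𝔖(N)` for even `N` (each factor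
  `(p-1)/(p-2)`, `p ≥ 3`, is `≥ 1`), hence `0 < 𝔖(N)` (`goldbachSingularSeries_pos`, using
  `C₂ > 0`, `twinPrimeConst_pos_holds`);
* `tendsto_goldbachSingularSeries_mul_div_log_sq` : the main term `𝔖(N) · N/(log N)² → ∞`
  along even `N`;
* `HardyLittlewoodGoldbach.tendsto_goldbachCount` : under Conjecture A, `R(N) → ∞` along even `N`;
* `HardyLittlewoodGoldbach.exists_forall_exists_prime_add_eq` : under Conjecture A there is `N₀`
  such that every even `N ≥ N₀` is a sum of two primes;
* `HardyLittlewoodGoldbach.exists_goldbachExceptionalCount_le` : under Conjecture A the Goldbach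
  exceptional count `E(x)` (`goldbachExceptionalCount`) is bounded.

### References for Appendix 2

* G. H. Hardy, J. E. Littlewood, *Some problems of 'Partitio numerorum'; III*, Acta Math. 44
  (1923), 1–70: `N_r(n)` §1.2 p. 6; §4.1 "Remarks on 'Goldbach's Theorem'", Conjecture A,
  (4·11)–(4·12), p. 32. doi:10.1007/BF02403921. [HardyLittlewood1923]
-/

/-! ### Conjecture A: the singular series is bounded below and the main term tends to infinity -/

/-- For even `N`, `2 C₂ ≤ 𝔖(N) = 2 C₂ ∏_{p ∣ N, p > 2} (p-1)/(p-2)`: every factor `(p-1)/(p-2)`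
(`p ≥ 3`) is `≥ 1`, and `C₂ > 0` (`twinPrimeConst_pos_holds`). Hardy–Littlewood 1923,
(4·11)–(4·12), p. 32. [cite: HardyLittlewood1923, Conjecture A, (4.11)-(4.12), p. 32] -/
theorem two_mul_twinPrimeConst_le_goldbachSingularSeries {N : ℕ} (hN : Even N) :
    2 * twinPrimeConst ≤ goldbachSingularSeries N := by
  rw [goldbachSingularSeries_of_even N hN]
  have hC₂ : (0 : ℝ) < twinPrimeConst := twinPrimeConst_pos_holds
  have h1 : (1 : ℝ) ≤ ∏ p ∈ N.primeFactors.filter (2 < ·), (((p : ℝ) - 1) / ((p : ℝ) - 2)) := by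
    refine Finset.one_le_prod fun p hp ↦ ?_
    have hp2 : (2 : ℝ) < p := by exact_mod_cast (Finset.mem_filter.1 hp).2
    rw [one_le_div (by linarith)]
    linarith
  calc 2 * twinPrimeConst = 2 * twinPrimeConst * 1 := (mul_one _).symm
    _ ≤ 2 * twinPrimeConst * ∏ p ∈ N.primeFactors.filter (2 < ·), (((p : ℝ) - 1) / ((p : ℝ) - 2)) :=
      mul_le_mul_of_nonneg_left h1 (by linarith)

/-- `0 < 𝔖(N)` for even `N` (from `2 C₂ ≤ 𝔖(N)` and `C₂ > 0`). Hardy–Littlewood 1923, (4·11),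
p. 32. [cite: HardyLittlewood1923, Conjecture A, (4.11)-(4.12), p. 32] -/
theorem goldbachSingularSeries_pos {N : ℕ} (hN : Even N) : 0 < goldbachSingularSeries N :=
  (mul_pos two_pos twinPrimeConst_pos_holds).trans_le
    (two_mul_twinPrimeConst_le_goldbachSingularSeries hN)

/-- The Hardy–Littlewood main term of Conjecture A tends to infinity through the even integers:
`𝔖(N) · N/(log N)² → ∞` along `atTop ⊓ 𝓟 {N | Even N}` (there `𝔖(N) ≥ 2 C₂ > 0`, and
`N/(log N)² → ∞`). Hardy–Littlewood 1923, (4·11), p. 32. [cite: HardyLittlewood1923, Conjecture A, (4.11), p. 32] -/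
theorem tendsto_goldbachSingularSeries_mul_div_log_sq :
    Tendsto (fun N : ℕ ↦ goldbachSingularSeries N * N / Real.log N ^ 2)
      (atTop ⊓ 𝓟 {N : ℕ | Even N}) atTop := by
  have hC₂ : (0 : ℝ) < twinPrimeConst := twinPrimeConst_pos_holds
  have h1 : Tendsto (fun N : ℕ ↦ 2 * twinPrimeConst * ((N : ℝ) / Real.log N ^ 2))
      (atTop ⊓ 𝓟 {N : ℕ | Even N}) atTop :=
    ((tendsto_natCast_div_log_pow_atTop 2).const_mul_atTop (mul_pos two_pos hC₂)).mono_left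
      inf_le_left
  refine tendsto_atTop_mono' _ (eventually_inf_principal.2 (Eventually.of_forall fun N hN ↦ ?_)) h1
  have hx : (0 : ℝ) ≤ (N : ℝ) / Real.log N ^ 2 := by positivity
  calc 2 * twinPrimeConst * ((N : ℝ) / Real.log N ^ 2)
      ≤ goldbachSingularSeries N * ((N : ℝ) / Real.log N ^ 2) :=
        mul_le_mul_of_nonneg_right (two_mul_twinPrimeConst_le_goldbachSingularSeries hN) hx
    _ = goldbachSingularSeries N * N / Real.log N ^ 2 := (mul_div_assoc _ _ _).symm

/-! ### Consequences of Conjecture A (why it is not discharged) -/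

/-- Under `HardyLittlewoodGoldbach` (Conjecture A), `R(N) → ∞` as `N → ∞` through even integers:
the main term `𝔖(N) N/(log N)²` tends to `∞` (`tendsto_goldbachSingularSeries_mul_div_log_sq`)
and `R ∼` main term. Hardy–Littlewood 1923, Conjecture A, p. 32. [cite: HardyLittlewood1923, Conjecture A, p. 32] -/
theorem HardyLittlewoodGoldbach.tendsto_goldbachCount (h : HardyLittlewoodGoldbach) :
    Tendsto (fun N : ℕ ↦ (SingularSeries.goldbachCount N : ℝ)) (atTop ⊓ 𝓟 {N : ℕ | Even N})
      atTop :=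
  h.symm.tendsto_atTop tendsto_goldbachSingularSeries_mul_div_log_sq

/-- Under `HardyLittlewoodGoldbach`, **every sufficiently large even `N` is a sum of two primes**
(the first clause of Conjecture A, "Every large even number is the sum of two odd primes",
follows from its asymptotic formula): there is `N₀` with `∃ p q prime, p + q = N` for all even
`N ≥ N₀`.  In particular a proof of the named fact would settle the binary Goldbach problem
(`Literature.NumberTheory.Sieve.GoldbachConjecture`, parity.S04) for all large `N`, which is open.
Hardy–Littlewood 1923, Conjecture A, p. 32. [cite: HardyLittlewood1923, Conjecture A, p. 32] -/
theorem HardyLittlewoodGoldbach.exists_forall_exists_prime_add_eq (h : HardyLittlewoodGoldbach) :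
    ∃ N₀ : ℕ, ∀ N : ℕ, N₀ ≤ N → Even N → ∃ p q : ℕ, p.Prime ∧ q.Prime ∧ p + q = N := by
  have hev : ∀ᶠ N : ℕ in atTop, N ∈ {N : ℕ | Even N} → 0 < (SingularSeries.goldbachCount N : ℝ) :=
    eventually_inf_principal.1 (h.tendsto_goldbachCount.eventually_gt_atTop 0)
  obtain ⟨N₀, hN₀⟩ := eventually_atTop.1 hev
  refine ⟨N₀, fun N hN hNe ↦ ?_⟩
  have hpos : 0 < SingularSeries.goldbachCount N := by exact_mod_cast hN₀ N hN hNe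
  unfold SingularSeries.goldbachCount at hpos
  obtain ⟨pq, hpq⟩ := Finset.card_pos.1 hpos
  rw [Finset.mem_filter] at hpq
  exact ⟨pq.1, pq.2, hpq.2.1, hpq.2.2, by simpa using hpq.1⟩

/-- Under `HardyLittlewoodGoldbach` the Goldbach exceptional set is finite: the exceptional count
`E(x) = #{N ≤ x : N even, N ≥ 4, R(N) = 0}` (`goldbachExceptionalCount`) is bounded, indeed
`E(x) ≤ N₀` with `N₀` from `HardyLittlewoodGoldbach.exists_forall_exists_prime_add_eq`.
(Unconditionally only `E(x) ≪ x^{1-δ}` is in the tree, `goldbachExceptionalCount_isBigO_rpow`.)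
Hardy–Littlewood 1923, Conjecture A, p. 32. [cite: HardyLittlewood1923, Conjecture A, p. 32] -/
theorem HardyLittlewoodGoldbach.exists_goldbachExceptionalCount_le (h : HardyLittlewoodGoldbach) :
    ∃ B : ℕ, ∀ x : ℕ, goldbachExceptionalCount x ≤ B := by
  obtain ⟨N₀, hN₀⟩ := h.exists_forall_exists_prime_add_eq
  refine ⟨N₀, fun x ↦ ?_⟩
  unfold goldbachExceptionalCount
  calc #{N ∈ range (x + 1) | Even N ∧ 4 ≤ N ∧ ParityWave0.goldbachCount N = 0}
      ≤ #(range N₀) := by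
        refine Finset.card_le_card fun N hN ↦ ?_
        rw [Finset.mem_filter] at hN
        rw [Finset.mem_range]
        by_contra hlt
        obtain ⟨p, q, hp, hq, hpq⟩ := hN₀ N (not_lt.1 hlt) hN.2.1
        have hpos : 0 < ParityWave0.goldbachCount N := by
          unfold ParityWave0.goldbachCount
          refine Finset.card_pos.2 ⟨(p, q), ?_⟩
          rw [Finset.mem_filter]
          exact ⟨by simpa using hpq, hp, hq⟩
        exact hpos.ne' hN.2.2.2
    _ = N₀ := Finset.card_range N₀

end Literature.NumberTheory.Sieve
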